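import Summits.Ventures.WeilGRH.ThirdPrimeReflectionTransfer
import Summits.Ventures.WeilGRH.TwoPrimeReflectionRungsClasses
import HarnessLib

/-!
# GRH arm (rh-explicit, venture WeilGRH): PROVED rungs on the two-prime window, the prime `3` reflected

Numerical instances of `weilPositivityOnChar_transfer_reflection_third` (reflect `3`, pay `2` crudely with
`δ₂ = (log 2/√2)‖1 − χ(2)‖ ≤ 0.49014·‖1 − χ(2)‖`) at the `ζ` rungs `59/100` and `log 2`:

* `a = 59/100`: `WeilPositivityOnChar χ (59/100)` for EVERY Dirichlet character of EVERY modulus `q ≥ 32`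
  (`TwoPrimeReflectionRungs`: `q ≥ 36`); for every character of EVEN modulus `q ≥ 20` (`20.3/20.7`);
  for `q ≥ 12` when `χ(2) = 1` (`15.14`, `17.16`).
* `a = log 2`: `WeilPositivityOnChar χ (log 2)` for EVERY character of EVERY modulus `q ≥ 50` (was `70`);
  even modulus `q ≥ 32`; `q ≥ 20` when `χ(2) = 1`; `q ≥ 13` when `χ(2) = 1`, `χ(3) = −1` (`17.16`).

Constants on the window `[log 3 − a, a]`: at `59/100` through `e^{59/100}` (`C_M ≤ 1.03945`,
`C_A ≤ 0.087697`, `I_A ≥ 0.087693`); at `log 2` exactly `C_M = 5/12 + log(3/2)`,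
`C_A = 1/6 + log 2 − (log 3)/2`, `I_A = (2 log 2 − log 3)/√3 + √3/12`; `k₃' ∈ [0.63428, 0.6343]`.
Margins ≥ 1.5 %.

## References

* A. Weil (1952), (11) and the «lemme» p. 262; H. Yoshida (1992) §6.
-/

noncomputable section

open Complex Filter Set MeasureTheory
open scoped Real Topology ComplexConjugate

namespace Summit.Ventures.WeilGRH

open Literature.NumberTheory.LFunctions

/-! ## Numerical constants on the window reflected at `log 3` -/

/-- `0.63428 ≤ k₃' = log 3/√3`. [folklore] -/
theorem kthree_ge : (0.63428 : ℝ) ≤ Real.log 3 / Real.sqrt 3 := by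
  obtain ⟨ht1, ht2⟩ := sqrt_three_bounds
  rw [le_div_iff₀ (by positivity)]
  linarith [Real.log_three_gt_d9]

/-- `cosh((log 3)/2) = 2√3/3` (`e^{(log 3)/2} = √3`). [folklore] -/
theorem cosh_log_three_half : Real.cosh (Real.log 3 / 2) = 2 * Real.sqrt 3 / 3 := by
  have hs : Real.sqrt 3 ≠ 0 := by positivity
  have hsq : Real.sqrt 3 * Real.sqrt 3 = 3 := Real.mul_self_sqrt (by norm_num)
  rw [Real.cosh_eq, Real.exp_neg,
    (by rw [Real.sqrt_eq_rpow, Real.rpow_def_of_pos (by norm_num : (0:ℝ) < 3)]; ring_nf :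
      Real.exp (Real.log 3 / 2) = Real.sqrt 3)]
  field_simp
  nlinarith [hsq]

/-- The constants of the window `[log 3 − 59/100, 59/100]` (`E = e^{59/100}`: `sinh(log 3 − 59/100) =
(3/E − E/3)/2`, `sinh(59/100 − (log 3)/2) = (E/√3 − √3/E)/2`): `C_M ≤ 1.03945`, `C_A ≤ 0.087697`,
`0.087693 ≤ I_A`. [folklore] -/
theorem fiftynine_constants_three :
    Real.sinh (Real.log 3 - 59 / 100) + (Real.log 3 - 59 / 100) ≤ 1.03945 ∧
    (Real.sinh (59 / 100) - Real.sinh (Real.log 3 - 59 / 100) +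
        (59 / 100 - (Real.log 3 - 59 / 100))) / 2 ≤ 0.087697 ∧
    (0.087693 : ℝ) ≤ (59 / 100 - (Real.log 3 - 59 / 100)) * Real.cosh (Real.log 3 / 2) / 2 +
        Real.sinh (59 / 100 - Real.log 3 / 2) := by
  obtain ⟨ht1, ht2⟩ := sqrt_three_bounds
  obtain ⟨he1, he2⟩ := exp_fiftynine_bounds
  have hl1 := Real.log_three_gt_d9
  have hl2 := Real.log_three_lt_d9
  set E := Real.exp (59 / 100) with hE
  have hE0 : 0 < E := Real.exp_pos _
  have hsq : Real.sqrt 3 * Real.sqrt 3 = 3 := Real.mul_self_sqrt (by norm_num)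
  have hs0 : 0 < Real.sqrt 3 := by positivity
  have he3 : Real.exp (Real.log 3 / 2) = Real.sqrt 3 := by
    rw [Real.sqrt_eq_rpow, Real.rpow_def_of_pos (by norm_num : (0:ℝ) < 3)]; ring_nf
  have hsinh1 : Real.sinh (59 / 100) = (E - E⁻¹) / 2 := by
    rw [Real.sinh_eq, Real.exp_neg]
  have hsinh2 : Real.sinh (Real.log 3 - 59 / 100) = (3 * E⁻¹ - E / 3) / 2 := by
    rw [Real.sinh_eq, Real.exp_neg, Real.exp_sub, Real.exp_log (by norm_num), ← hE]
    field_simp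
  have hsinh3 : Real.sinh (59 / 100 - Real.log 3 / 2) = (E / Real.sqrt 3 - Real.sqrt 3 / E) / 2 := by
    rw [Real.sinh_eq, Real.exp_neg, Real.exp_sub, he3, ← hE]
    field_simp
  have hinv1 : E⁻¹ ≤ 1 / 1.8039884 := by
    rw [inv_eq_one_div]; exact one_div_le_one_div_of_le (by norm_num) he1
  have hinv2 : 1 / 1.8039885 ≤ E⁻¹ := by
    rw [inv_eq_one_div]; exact one_div_le_one_div_of_le hE0 he2
  rw [hsinh1, hsinh2, hsinh3, cosh_log_three_half]
  refine ⟨?_, ?_, ?_⟩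
  · norm_num at hinv1 ⊢; linarith
  · norm_num at hinv2 ⊢; linarith
  · have hq1 : (1.8039884 : ℝ) / 1.732051 ≤ E / Real.sqrt 3 := by
      rw [div_le_div_iff₀ (by norm_num) hs0]; nlinarith
    have hq2 : Real.sqrt 3 / E ≤ 1.732051 / 1.8039884 := by
      rw [div_le_div_iff₀ hE0 (by norm_num)]; nlinarith
    norm_num at hq1 hq2 ⊢
    nlinarith

/-- The constants of the window `[log 3 − log 2, log 2]` (`sinh(log 3 − log 2) = 5/12`, `sinh(log 2) = 3/4`,
`sinh(log 2 − (log 3)/2) = √3/12`): `C_M ≤ 0.82214`, `C_A ≤ 0.31051`, `0.31043 ≤ I_A`. [folklore] -/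
theorem log_two_constants_three :
    Real.sinh (Real.log 3 - Real.log 2) + (Real.log 3 - Real.log 2) ≤ 0.82214 ∧
    (Real.sinh (Real.log 2) - Real.sinh (Real.log 3 - Real.log 2) +
        (Real.log 2 - (Real.log 3 - Real.log 2))) / 2 ≤ 0.31051 ∧
    (0.31043 : ℝ) ≤ (Real.log 2 - (Real.log 3 - Real.log 2)) * Real.cosh (Real.log 3 / 2) / 2 +
        Real.sinh (Real.log 2 - Real.log 3 / 2) := by
  obtain ⟨ht1, ht2⟩ := sqrt_three_bounds
  have hl1 := Real.log_three_gt_d9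
  have hl2 := Real.log_three_lt_d9
  have hm1 := Real.log_two_gt_d9
  have hm2 := Real.log_two_lt_d9
  have hsinh1 : Real.sinh (Real.log 2) = 3 / 4 := by
    rw [Real.sinh_eq, Real.exp_neg, Real.exp_log (by norm_num)]; norm_num
  have hsinh2 : Real.sinh (Real.log 3 - Real.log 2) = 5 / 12 := by
    rw [Real.sinh_eq, Real.exp_neg, Real.exp_sub, Real.exp_log (by norm_num),
      Real.exp_log (by norm_num)]
    norm_num
  rw [hsinh1, hsinh2, sinh_log_two_sub_log_three_half, cosh_log_three_half]
  refine ⟨by linarith, by linarith, by nlinarith⟩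

variable {q : ℕ}

/-- `(log 2/√2)‖1 − χ(2)‖ ≤ 0.98028` always, `≤ 0.49014` if `χ(2) = 0`, `≤ 0` if `χ(2) = 1`. [folklore] -/
theorem ktwo_mul_norm_le (χ : DirichletCharacter ℂ q) :
    Real.log 2 / Real.sqrt 2 * ‖1 - χ (2 : ZMod q)‖ ≤ 0.98028 := by
  have h2 : ‖1 - χ (2 : ZMod q)‖ ≤ 2 := by
    nlinarith [normSq_one_sub_char_le_four χ, norm_nonneg (1 - χ (2 : ZMod q))]
  have := mul_le_mul kprime_bounds.2 h2 (norm_nonneg _) (by norm_num)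
  linarith

/-! ## The rung `59/100` -/

/-- The rung `59/100` from the bounded criterion on the window reflected at `log 3`: `B ≤ log q`,
`1.3 + δ ≤ B`, `(log 2/√2)‖1 − χ(2)‖ ≤ δ`, `σ₀ ≤ ‖1 − χ(3)‖² ≤ σ₁ ≤ 4`, rational checks at `σ₀, σ₁`
(curve `ρ = σ/2` for `u₃ = 1 − χ(3)`). [cite: Weil1952FormulesExplicites, the «lemme» p. 262; Yoshida1992 §6] -/
theorem weilPositivityOnChar_fiftynine_of_curve_three [NeZero q] (hq1 : q ≠ 1)
    (χ : DirichletCharacter ℂ q) {B δ σ₀ σ₁ : ℝ} (hBq : B ≤ Real.log q) (hB1 : 1.3 + δ ≤ B)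
    (hδ : Real.log 2 / Real.sqrt 2 * ‖1 - χ (2 : ZMod q)‖ ≤ δ)
    (hσ₀ : σ₀ ≤ ‖1 - χ (3 : ZMod q)‖ ^ 2) (hσ₁ : ‖1 - χ (3 : ZMod q)‖ ^ 2 ≤ σ₁) (hσ₀0 : 0 ≤ σ₀)
    (hσ₁4 : σ₁ ≤ 4)
    (h0 : 2 * (1.03945 * ((B - δ) ^ 2 - 0.63428 ^ 2 * σ₀) +
        2 * (B - δ) * ((B - δ) * 0.087697 - 0.63428 * (σ₀ / 2) * 0.087693)) ≤
      (B - δ) * ((B - δ) ^ 2 - 0.6343 ^ 2 * σ₀))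
    (h1 : 2 * (1.03945 * ((B - δ) ^ 2 - 0.63428 ^ 2 * σ₁) +
        2 * (B - δ) * ((B - δ) * 0.087697 - 0.63428 * (σ₁ / 2) * 0.087693)) ≤
      (B - δ) * ((B - δ) ^ 2 - 0.6343 ^ 2 * σ₁)) :
    WeilPositivityOnChar χ (59 / 100) := by
  obtain ⟨hCM, hCA, hIA⟩ := fiftynine_constants_three
  set k₃ := Real.log 3 / Real.sqrt 3 with hk₃
  set u : ℂ := 1 - χ (3 : ZMod q) with hu
  have hδ0 : 0 ≤ δ := le_trans (by positivity) hδ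
  have hB' : 0 < B - δ := by linarith
  have hsq : (1.69 : ℝ) ≤ (B - δ) ^ 2 := by nlinarith
  have hk0 : 0 ≤ k₃ := le_trans (by norm_num) kthree_ge
  have hIA0 : (0 : ℝ) ≤ (59 / 100 - (Real.log 3 - 59 / 100)) * Real.cosh (Real.log 3 / 2) / 2 +
      Real.sinh (59 / 100 - Real.log 3 / 2) := by linarith
  have hu4 := normSq_one_sub_char_le_four χ
  have hend : ∀ s : ℝ, 0 ≤ s → s ≤ 4 →
      2 * (1.03945 * ((B - δ) ^ 2 - 0.63428 ^ 2 * s) +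
        2 * (B - δ) * ((B - δ) * 0.087697 - 0.63428 * (s / 2) * 0.087693)) ≤
          (B - δ) * ((B - δ) ^ 2 - 0.6343 ^ 2 * s) →
      2 * ((Real.sinh (Real.log 3 - 59 / 100) + (Real.log 3 - 59 / 100)) * ((B - δ) ^ 2 - k₃ ^ 2 * s) +
        2 * (B - δ) * ((B - δ) * ((Real.sinh (59 / 100) - Real.sinh (Real.log 3 - 59 / 100) +
          (59 / 100 - (Real.log 3 - 59 / 100))) / 2) -
          k₃ * (s / 2) * ((59 / 100 - (Real.log 3 - 59 / 100)) * Real.cosh (Real.log 3 / 2) / 2 +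
            Real.sinh (59 / 100 - Real.log 3 / 2)))) ≤ (B - δ) * ((B - δ) ^ 2 - k₃ ^ 2 * s) :=
    fun s hs0 hs4 hnum ↦ reflection_criterion_of_bounds hCM hCA hIA (by norm_num) (by linarith) hs0
      kthree_ge kthree_le (by norm_num) hB' (by norm_num) (by nlinarith [hsq, hs4]) hnum
  have hσ3 : ‖1 - χ (3 : ZMod q)‖ ^ 2 ≤ 4 := by
    have h : ‖1 - χ (3 : ZMod q)‖ ≤ 2 := norm_one_sub_char_three_le χ
    nlinarith [norm_nonneg (1 - χ (3 : ZMod q))]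
  have hcrit := reflection_criterion_interpolate (ρ := u.re) hk0 hIA0 hB'.le
    (hend σ₀ hσ₀0 (by linarith) h0) (hend σ₁ (by linarith) hσ₁4 h1) hσ₀ hσ₁
    (normSq_one_sub_half_le_re (χ.norm_le_one _))
  have hl3 := Real.log_three_lt_d9
  have hl2 := Real.log_two_gt_d9
  refine weilPositivityOnChar_transfer_reflection_third (B := B) (κ := k₃ * ‖u‖) (δ := δ)
    (by linarith) (by linarith) weilPositivityOn_59_100 hq1 χ hBq (by rw [hk₃, hu]) hδ ?_
    rfl rfl rfl rfl ?_
  · have h2 : ‖u‖ ≤ 2 := by nlinarith [hσ3, norm_nonneg u]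
    have := mul_le_mul kthree_le h2 (norm_nonneg _) (by norm_num)
    nlinarith [norm_nonneg u]
  · rw [mul_pow]
    exact hcrit

/-- **The rung `59/100` for EVERY Dirichlet character of EVERY modulus `q ≥ 32`** (`B = 3.465 ≤ 5 log 2`,
`δ₂ = 0.98028`). [cite: Weil1952FormulesExplicites, the «lemme» p. 262; Yoshida1992 §6] -/
theorem weilPositivityOnChar_fiftynine_of_ge_32 (hq : 32 ≤ q) (χ : DirichletCharacter ℂ q) :
    WeilPositivityOnChar χ (59 / 100) := by
  have hq1 : q ≠ 1 := by omega
  haveI : NeZero q := ⟨by omega⟩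
  have hBq : (3.465 : ℝ) ≤ Real.log q := by
    have h := Real.log_le_log (by norm_num) (by exact_mod_cast hq : (32 : ℝ) ≤ q)
    rw [show (32 : ℝ) = 2 ^ 5 by norm_num, Real.log_pow] at h
    push_cast at h
    linarith [Real.log_two_gt_d9]
  have hσ3 : ‖1 - χ (3 : ZMod q)‖ ^ 2 ≤ 4 := by
    have h : ‖1 - χ (3 : ZMod q)‖ ≤ 2 := norm_one_sub_char_three_le χ
    nlinarith [norm_nonneg (1 - χ (3 : ZMod q))]
  exact weilPositivityOnChar_fiftynine_of_curve_three hq1 χ hBq (by norm_num) (ktwo_mul_norm_le χ)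
    (sq_nonneg _) hσ3 le_rfl le_rfl (by norm_num) (by norm_num)

/-- **The rung `59/100` for every character of EVEN modulus `q ≥ 20`** (`χ(2) = 0`, `δ₂ = 0.49014`,
`B = 2.995 ≤ log 20`; classes `20.3/20.7`, `20.19`). [cite: Weil1952FormulesExplicites, the «lemme» p. 262; Yoshida1992 §6] -/
theorem weilPositivityOnChar_fiftynine_of_even_ge_20 (hq : 20 ≤ q) (heven : Even q)
    (χ : DirichletCharacter ℂ q) : WeilPositivityOnChar χ (59 / 100) := by
  have hq1 : q ≠ 1 := by omega
  haveI : NeZero q := ⟨by omega⟩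
  have hχ2 : χ (2 : ZMod q) = 0 := by
    refine χ.map_nonunit fun hunit ↦ ?_
    have hcop := (ZMod.isUnit_iff_coprime 2 q).1 (by exact_mod_cast hunit)
    obtain ⟨r, hr⟩ := heven
    have h2 : 2 ∣ q := ⟨r, by omega⟩
    have := Nat.Coprime.eq_one_of_dvd hcop h2
    omega
  have hBq : (2.995 : ℝ) ≤ Real.log q := by
    have h := Real.log_le_log (by norm_num) (by exact_mod_cast hq : (20 : ℝ) ≤ q)
    rw [show (20 : ℝ) = 2 ^ 2 * 5 by norm_num, Real.log_mul (by norm_num) (by norm_num),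
      Real.log_pow] at h
    push_cast at h
    linarith [Real.log_two_gt_d9, Real.log_five_gt_d9]
  have hδ : Real.log 2 / Real.sqrt 2 * ‖1 - χ (2 : ZMod q)‖ ≤ 0.49014 := by
    rw [hχ2, sub_zero, norm_one, mul_one]; exact kprime_bounds.2
  have hσ3 : ‖1 - χ (3 : ZMod q)‖ ^ 2 ≤ 4 := by
    have h : ‖1 - χ (3 : ZMod q)‖ ≤ 2 := norm_one_sub_char_three_le χ
    nlinarith [norm_nonneg (1 - χ (3 : ZMod q))]
  exact weilPositivityOnChar_fiftynine_of_curve_three hq1 χ hBq (by norm_num) hδ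
    (sq_nonneg _) hσ3 le_rfl le_rfl (by norm_num) (by norm_num)

/-- **The rung `59/100` for `q ≥ 12` when `χ(2) = 1`** (`δ₂ = 0`, `B = 2.4849 ≤ log 12`; classes `15.14`,
`17.16`). [cite: Weil1952FormulesExplicites, the «lemme» p. 262; Yoshida1992 §6] -/
theorem weilPositivityOnChar_fiftynine_of_trivial_at_two (hq : 12 ≤ q) (χ : DirichletCharacter ℂ q)
    (hχ : χ (2 : ZMod q) = 1) : WeilPositivityOnChar χ (59 / 100) := by
  have hq1 : q ≠ 1 := by omega
  haveI : NeZero q := ⟨by omega⟩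
  have hBq : (2.4849 : ℝ) ≤ Real.log q := by
    have h := Real.log_le_log (by norm_num) (by exact_mod_cast hq : (12 : ℝ) ≤ q)
    rw [show (12 : ℝ) = 2 ^ 2 * 3 by norm_num, Real.log_mul (by norm_num) (by norm_num),
      Real.log_pow] at h
    push_cast at h
    linarith [Real.log_two_gt_d9, Real.log_three_gt_d9]
  have hδ : Real.log 2 / Real.sqrt 2 * ‖1 - χ (2 : ZMod q)‖ ≤ 0 := by
    rw [hχ, sub_self, norm_zero, mul_zero]
  have hσ3 : ‖1 - χ (3 : ZMod q)‖ ^ 2 ≤ 4 := by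
    have h : ‖1 - χ (3 : ZMod q)‖ ≤ 2 := norm_one_sub_char_three_le χ
    nlinarith [norm_nonneg (1 - χ (3 : ZMod q))]
  exact weilPositivityOnChar_fiftynine_of_curve_three hq1 χ hBq (by norm_num) hδ
    (sq_nonneg _) hσ3 le_rfl le_rfl (by norm_num) (by norm_num)

/-! ## The rung `log 2` -/

/-- The rung `log 2` from the bounded criterion on the window reflected at `log 3`.
[cite: Weil1952FormulesExplicites, the «lemme» p. 262; Yoshida1992 §6] -/
theorem weilPositivityOnChar_log_two_of_curve_three [NeZero q] (hq1 : q ≠ 1)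
    (χ : DirichletCharacter ℂ q) {B δ σ₀ σ₁ : ℝ} (hBq : B ≤ Real.log q) (hB1 : 1.3 + δ ≤ B)
    (hδ : Real.log 2 / Real.sqrt 2 * ‖1 - χ (2 : ZMod q)‖ ≤ δ)
    (hσ₀ : σ₀ ≤ ‖1 - χ (3 : ZMod q)‖ ^ 2) (hσ₁ : ‖1 - χ (3 : ZMod q)‖ ^ 2 ≤ σ₁) (hσ₀0 : 0 ≤ σ₀)
    (hσ₁4 : σ₁ ≤ 4)
    (h0 : 2 * (0.82214 * ((B - δ) ^ 2 - 0.63428 ^ 2 * σ₀) +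
        2 * (B - δ) * ((B - δ) * 0.31051 - 0.63428 * (σ₀ / 2) * 0.31043)) ≤
      (B - δ) * ((B - δ) ^ 2 - 0.6343 ^ 2 * σ₀))
    (h1 : 2 * (0.82214 * ((B - δ) ^ 2 - 0.63428 ^ 2 * σ₁) +
        2 * (B - δ) * ((B - δ) * 0.31051 - 0.63428 * (σ₁ / 2) * 0.31043)) ≤
      (B - δ) * ((B - δ) ^ 2 - 0.6343 ^ 2 * σ₁)) :
    WeilPositivityOnChar χ (Real.log 2) := by
  obtain ⟨hCM, hCA, hIA⟩ := log_two_constants_three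
  set k₃ := Real.log 3 / Real.sqrt 3 with hk₃
  set u : ℂ := 1 - χ (3 : ZMod q) with hu
  have hδ0 : 0 ≤ δ := le_trans (by positivity) hδ
  have hB' : 0 < B - δ := by linarith
  have hsq : (1.69 : ℝ) ≤ (B - δ) ^ 2 := by nlinarith
  have hk0 : 0 ≤ k₃ := le_trans (by norm_num) kthree_ge
  have hIA0 : (0 : ℝ) ≤ (Real.log 2 - (Real.log 3 - Real.log 2)) * Real.cosh (Real.log 3 / 2) / 2 +
      Real.sinh (Real.log 2 - Real.log 3 / 2) := by linarith
  have hend : ∀ s : ℝ, 0 ≤ s → s ≤ 4 →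
      2 * (0.82214 * ((B - δ) ^ 2 - 0.63428 ^ 2 * s) +
        2 * (B - δ) * ((B - δ) * 0.31051 - 0.63428 * (s / 2) * 0.31043)) ≤
          (B - δ) * ((B - δ) ^ 2 - 0.6343 ^ 2 * s) →
      2 * ((Real.sinh (Real.log 3 - Real.log 2) + (Real.log 3 - Real.log 2)) *
          ((B - δ) ^ 2 - k₃ ^ 2 * s) +
        2 * (B - δ) * ((B - δ) * ((Real.sinh (Real.log 2) - Real.sinh (Real.log 3 - Real.log 2) +
          (Real.log 2 - (Real.log 3 - Real.log 2))) / 2) -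
          k₃ * (s / 2) * ((Real.log 2 - (Real.log 3 - Real.log 2)) * Real.cosh (Real.log 3 / 2) / 2 +
            Real.sinh (Real.log 2 - Real.log 3 / 2)))) ≤ (B - δ) * ((B - δ) ^ 2 - k₃ ^ 2 * s) :=
    fun s hs0 hs4 hnum ↦ reflection_criterion_of_bounds hCM hCA hIA (by norm_num) (by linarith) hs0
      kthree_ge kthree_le (by norm_num) hB' (by norm_num) (by nlinarith [hsq, hs4]) hnum
  have hσ3 : ‖1 - χ (3 : ZMod q)‖ ^ 2 ≤ 4 := by
    have h : ‖1 - χ (3 : ZMod q)‖ ≤ 2 := norm_one_sub_char_three_le χ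
    nlinarith [norm_nonneg (1 - χ (3 : ZMod q))]
  have hcrit := reflection_criterion_interpolate (ρ := u.re) hk0 hIA0 hB'.le
    (hend σ₀ hσ₀0 (by linarith) h0) (hend σ₁ (by linarith) hσ₁4 h1) hσ₀ hσ₁
    (normSq_one_sub_half_le_re (χ.norm_le_one _))
  have hlog : Real.log 3 < 2 * Real.log 2 := by
    rw [← Real.log_rpow (by norm_num), show ((2 : ℝ) ^ (2 : ℝ)) = 4 by norm_num]
    exact Real.log_lt_log (by norm_num) (by norm_num)
  refine weilPositivityOnChar_transfer_reflection_third (B := B) (κ := k₃ * ‖u‖) (δ := δ)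
    hlog le_rfl Summit.RiemannHypothesis.RiemannHypothesis.Theorems.EvenWinsBeyondArch.weilPositivityOn_log_two
    hq1 χ hBq (by rw [hk₃, hu]) hδ ?_ rfl rfl rfl rfl ?_
  · have h2 : ‖u‖ ≤ 2 := by nlinarith [hσ3, norm_nonneg u]
    have := mul_le_mul kthree_le h2 (norm_nonneg _) (by norm_num)
    nlinarith [norm_nonneg u]
  · rw [mul_pow]
    exact hcrit

/-- **The rung `log 2` for EVERY Dirichlet character of EVERY modulus `q ≥ 50`** (`B = 3.912 ≤ log 2 +
2 log 5`, `δ₂ = 0.98028`; `TwoPrimeReflectionRungs`: `q ≥ 70`). [cite: Weil1952FormulesExplicites, the «lemme» p. 262; Yoshida1992 §6] -/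
theorem weilPositivityOnChar_log_two_of_ge_50 (hq : 50 ≤ q) (χ : DirichletCharacter ℂ q) :
    WeilPositivityOnChar χ (Real.log 2) := by
  have hq1 : q ≠ 1 := by omega
  haveI : NeZero q := ⟨by omega⟩
  have hBq : (3.912 : ℝ) ≤ Real.log q := by
    have h := Real.log_le_log (by norm_num) (by exact_mod_cast hq : (50 : ℝ) ≤ q)
    rw [show (50 : ℝ) = 2 * 5 ^ 2 by norm_num, Real.log_mul (by norm_num) (by norm_num),
      Real.log_pow] at h
    push_cast at h
    linarith [Real.log_two_gt_d9, Real.log_five_gt_d9]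
  have hσ3 : ‖1 - χ (3 : ZMod q)‖ ^ 2 ≤ 4 := by
    have h : ‖1 - χ (3 : ZMod q)‖ ≤ 2 := norm_one_sub_char_three_le χ
    nlinarith [norm_nonneg (1 - χ (3 : ZMod q))]
  exact weilPositivityOnChar_log_two_of_curve_three hq1 χ hBq (by norm_num) (ktwo_mul_norm_le χ)
    (sq_nonneg _) hσ3 le_rfl le_rfl (by norm_num) (by norm_num)

/-- **The rung `log 2` for every character of EVEN modulus `q ≥ 32`** (`δ₂ = 0.49014`, `B = 3.465`).
[cite: Weil1952FormulesExplicites, the «lemme» p. 262; Yoshida1992 §6] -/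
theorem weilPositivityOnChar_log_two_of_even_ge_32 (hq : 32 ≤ q) (heven : Even q)
    (χ : DirichletCharacter ℂ q) : WeilPositivityOnChar χ (Real.log 2) := by
  have hq1 : q ≠ 1 := by omega
  haveI : NeZero q := ⟨by omega⟩
  have hχ2 : χ (2 : ZMod q) = 0 := by
    refine χ.map_nonunit fun hunit ↦ ?_
    have hcop := (ZMod.isUnit_iff_coprime 2 q).1 (by exact_mod_cast hunit)
    obtain ⟨r, hr⟩ := heven
    have h2 : 2 ∣ q := ⟨r, by omega⟩
    have := Nat.Coprime.eq_one_of_dvd hcop h2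
    omega
  have hBq : (3.465 : ℝ) ≤ Real.log q := by
    have h := Real.log_le_log (by norm_num) (by exact_mod_cast hq : (32 : ℝ) ≤ q)
    rw [show (32 : ℝ) = 2 ^ 5 by norm_num, Real.log_pow] at h
    push_cast at h
    linarith [Real.log_two_gt_d9]
  have hδ : Real.log 2 / Real.sqrt 2 * ‖1 - χ (2 : ZMod q)‖ ≤ 0.49014 := by
    rw [hχ2, sub_zero, norm_one, mul_one]; exact kprime_bounds.2
  have hσ3 : ‖1 - χ (3 : ZMod q)‖ ^ 2 ≤ 4 := by
    have h : ‖1 - χ (3 : ZMod q)‖ ≤ 2 := norm_one_sub_char_three_le χ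
    nlinarith [norm_nonneg (1 - χ (3 : ZMod q))]
  exact weilPositivityOnChar_log_two_of_curve_three hq1 χ hBq (by norm_num) hδ
    (sq_nonneg _) hσ3 le_rfl le_rfl (by norm_num) (by norm_num)

/-- **The rung `log 2` for `q ≥ 20` when `χ(2) = 1`** (`δ₂ = 0`, `B = 2.995`).
[cite: Weil1952FormulesExplicites, the «lemme» p. 262; Yoshida1992 §6] -/
theorem weilPositivityOnChar_log_two_of_trivial_at_two (hq : 20 ≤ q) (χ : DirichletCharacter ℂ q)
    (hχ : χ (2 : ZMod q) = 1) : WeilPositivityOnChar χ (Real.log 2) := by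
  have hq1 : q ≠ 1 := by omega
  haveI : NeZero q := ⟨by omega⟩
  have hBq : (2.995 : ℝ) ≤ Real.log q := by
    have h := Real.log_le_log (by norm_num) (by exact_mod_cast hq : (20 : ℝ) ≤ q)
    rw [show (20 : ℝ) = 2 ^ 2 * 5 by norm_num, Real.log_mul (by norm_num) (by norm_num),
      Real.log_pow] at h
    push_cast at h
    linarith [Real.log_two_gt_d9, Real.log_five_gt_d9]
  have hδ : Real.log 2 / Real.sqrt 2 * ‖1 - χ (2 : ZMod q)‖ ≤ 0 := by
    rw [hχ, sub_self, norm_zero, mul_zero]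
  have hσ3 : ‖1 - χ (3 : ZMod q)‖ ^ 2 ≤ 4 := by
    have h : ‖1 - χ (3 : ZMod q)‖ ≤ 2 := norm_one_sub_char_three_le χ
    nlinarith [norm_nonneg (1 - χ (3 : ZMod q))]
  exact weilPositivityOnChar_log_two_of_curve_three hq1 χ hBq (by norm_num) hδ
    (sq_nonneg _) hσ3 le_rfl le_rfl (by norm_num) (by norm_num)

/-- **The rung `log 2` for `q ≥ 13` when `χ(2) = 1` and `χ(3) = −1`** (`σ₃ = 4`, `δ₂ = 0`, `B = 2.56`;
class `17.16`). [cite: Weil1952FormulesExplicites, the «lemme» p. 262; Yoshida1992 §6] -/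
theorem weilPositivityOnChar_log_two_of_trivial_at_two_quadratic_at_three (hq : 13 ≤ q)
    (χ : DirichletCharacter ℂ q) (hχ : χ (2 : ZMod q) = 1) (h3 : χ (3 : ZMod q) = -1) :
    WeilPositivityOnChar χ (Real.log 2) := by
  have hq1 : q ≠ 1 := by omega
  haveI : NeZero q := ⟨by omega⟩
  have hBq : (2.56 : ℝ) ≤ Real.log q :=
    log_thirteen_ge.trans (Real.log_le_log (by norm_num) (by exact_mod_cast hq))
  have hδ : Real.log 2 / Real.sqrt 2 * ‖1 - χ (2 : ZMod q)‖ ≤ 0 := by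
    rw [hχ, sub_self, norm_zero, mul_zero]
  have hσ : ‖1 - χ (3 : ZMod q)‖ ^ 2 = 4 := by rw [h3]; norm_num
  exact weilPositivityOnChar_log_two_of_curve_three hq1 χ hBq (by norm_num) hδ
    hσ.symm.le hσ.le (by norm_num) le_rfl (by norm_num) (by norm_num)

end Summit.Ventures.WeilGRH
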